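import Summits.CriticalPhenomena.PercolationContinuityZ3.Theorems.SahiBoxTP2TiltHilbert
import Summits.CriticalPhenomena.PercolationContinuityZ3.Theorems.SahiIsingGibbsStates

/-!
# Box-TP₂ on spin spaces `{0,1}^ℕ`, `{−1,+1}^ι` is preserved by continuous log-supermodular tilts

Support file of the Sahi cell (`prim-sahi`, typer seat, generation 14; `--supports stmt-CriticalPhenomena-4575`).
Theorems only (no definitions, no named facts, no sorries).  Discrete companion of `SahiBoxTP2TiltHilbert.lean`,
and the model-independent form of generation 13's `isBoxTP2_isingMeasure`: **every Gibbs modification `e^{−H} μ` of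
a box-TP₂ law `μ` on `{−1,+1}^ι` by a continuous (quasilocal) ferromagnetic = submodular energy `H` is box-TP₂** —
arbitrary (absolutely summable, any range) pair or many-body ferromagnetic couplings, arbitrary fields, arbitrary
box-TP₂ reference law (product Bernoulli frozen on a boundary condition, another Gibbs state, …).

* `isBoxTP2_withDensity_of_latticeCondition_finite` — on a finite distributive lattice, tilting a box-TP₂ finite
  measure by a log-supermodular function gives a box-TP₂ measure (point weights; four functions theorem).
* `IsBoxTP2.withDensity_cylinder_bool` — `{0,1}^ℕ`, cylinder densities `ρ₀(u_0,…,u_{D−1})` (marginals of dimension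
  `d ≥ D`, `isBoxTP2_of_eventually_map_finRestrict`, `map_withDensity_comp`).
* `IsBoxTP2.withDensity_of_continuous_bool` — `{0,1}^ℕ`, every continuous log-supermodular `ρ` (pad with `⊤` beyond
  `D`, bounded pointwise convergence by continuity and compactness, setwise limit, `IsBoxTP2.of_limsup_liminf`).
* `IsBoxTP2.withDensity_of_continuous_spinConfig` — `{−1,+1}^ι`, `ι` countable (transport along `{−1,+1} ≃ {0,1}`
  and a relabelling `ι ≃ ℕ`); `IsBoxTP2.withDensity_exp_of_submodular_spinConfig` — `e^{−H} μ`.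

No sorries, no new axioms.
-/

noncomputable section

namespace Summit.CriticalPhenomena.PercolationContinuityZ3.Theorems.SahiBoxTP2

open MeasureTheory Set Filter Topology Function Literature.Combinatorics.Sahi2008
open Literature.Probability.LatticeModels
open scoped ENNReal NNReal

/-! ### Finite distributive lattices -/

/-- **Tilting a box-TP₂ finite measure on a finite distributive lattice by a log-supermodular function gives a
box-TP₂ measure** (points are boxes, so the point weights of `ν` satisfy the lattice condition; multiply; four
functions). [folklore] -/
theorem isBoxTP2_withDensity_of_latticeCondition_finite {α : Type*} [DistribLattice α] [Fintype α]
    [MeasurableSpace α] [MeasurableSingletonClass α] (ν : Measure α) [IsFiniteMeasure ν] (hν : IsBoxTP2 ν)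
    {g : α → ℝ≥0} (hg : ∀ a b, g a * g b ≤ g (a ⊓ b) * g (a ⊔ b)) :
    IsBoxTP2 (ν.withDensity fun a => (g a : ℝ≥0∞)) := by
  haveI : IsFiniteMeasure (ν.withDensity fun a => (g a : ℝ≥0∞)) := by
    refine isFiniteMeasure_withDensity (ne_of_lt ?_)
    calc ∫⁻ a, (g a : ℝ≥0∞) ∂ν ≤ ∫⁻ _, ((Finset.univ.sup g : ℝ≥0) : ℝ≥0∞) ∂ν :=
          lintegral_mono fun a => ENNReal.coe_le_coe.2 (Finset.le_sup (Finset.mem_univ a))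
      _ = (Finset.univ.sup g : ℝ≥0) * ν univ := lintegral_const _
      _ < ∞ := ENNReal.mul_lt_top ENNReal.coe_lt_top (measure_lt_top _ _)
  refine isBoxTP2_of_latticeCondition_singleton _ fun a b => ?_
  have hpt : ∀ x : α, (ν.withDensity fun a => (g a : ℝ≥0∞)).real {x} = (g x : ℝ) * ν.real {x} := by
    intro x
    rw [measureReal_def, withDensity_apply _ (measurableSet_singleton x), lintegral_singleton, ENNReal.toReal_mul,
      ENNReal.coe_toReal, measureReal_def]
  have hνpt : ν.real {a} * ν.real {b} ≤ ν.real {a ⊓ b} * ν.real {a ⊔ b} := by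
    have h := hν a a b b
    simp only [Icc_self] at h
    simp only [measureReal_def]
    rw [← ENNReal.toReal_mul, ← ENNReal.toReal_mul]
    exact ENNReal.toReal_mono (ENNReal.mul_ne_top (measure_ne_top ν _) (measure_ne_top ν _)) h
  have hg' : (g a : ℝ) * g b ≤ g (a ⊓ b) * g (a ⊔ b) := by exact_mod_cast hg a b
  rw [hpt, hpt, hpt, hpt]
  calc (g a : ℝ) * ν.real {a} * ((g b : ℝ) * ν.real {b}) = (g a : ℝ) * g b * (ν.real {a} * ν.real {b}) := by ring
    _ ≤ (g (a ⊓ b) : ℝ) * g (a ⊔ b) * (ν.real {a ⊓ b} * ν.real {a ⊔ b}) :=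
        mul_le_mul hg' hνpt (mul_nonneg measureReal_nonneg measureReal_nonneg)
          (mul_nonneg (NNReal.coe_nonneg _) (NNReal.coe_nonneg _))
    _ = (g (a ⊓ b) : ℝ) * ν.real {a ⊓ b} * ((g (a ⊔ b) : ℝ) * ν.real {a ⊔ b}) := by ring

/-! ### `{0,1}^ℕ`: cylinder tilts, then continuous tilts -/

section BoolSpins

variable {μ : Measure (ℕ → Bool)} [IsFiniteMeasure μ]

/-- **Cylinder tilts preserve box-TP₂ on `{0,1}^ℕ`**: for a finite box-TP₂ measure `μ` and ANY log-supermodular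
`ρ₀ : {0,1}^D → ℝ≥0`, the measure `ρ₀(u_0,…,u_{D−1}) · μ` is box-TP₂. [this work] -/
theorem IsBoxTP2.withDensity_cylinder_bool (hμ : IsBoxTP2 μ) {D : ℕ} {ρ₀ : (Fin D → Bool) → ℝ≥0}
    (hρ : ∀ x y, ρ₀ x * ρ₀ y ≤ ρ₀ (x ⊓ y) * ρ₀ (x ⊔ y)) :
    IsBoxTP2 (μ.withDensity fun u => (ρ₀ (finRestrict D u) : ℝ≥0∞)) := by
  haveI : IsFiniteMeasure (μ.withDensity fun u => (ρ₀ (finRestrict D u) : ℝ≥0∞)) := by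
    refine isFiniteMeasure_withDensity (ne_of_lt ?_)
    calc ∫⁻ u, (ρ₀ (finRestrict D u) : ℝ≥0∞) ∂μ ≤ ∫⁻ _, ((Finset.univ.sup ρ₀ : ℝ≥0) : ℝ≥0∞) ∂μ :=
          lintegral_mono fun u => ENNReal.coe_le_coe.2 (Finset.le_sup (Finset.mem_univ _))
      _ = (Finset.univ.sup ρ₀ : ℝ≥0) * μ univ := lintegral_const _
      _ < ∞ := ENNReal.mul_lt_top ENNReal.coe_lt_top (measure_lt_top _ _)
  have hIcc : ∀ (d : ℕ) (a b : Fin d → Bool), MeasurableSet (Icc a b) := fun d a b => (Set.toFinite _).measurableSet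
  refine isBoxTP2_of_eventually_map_finRestrict hIcc (eventually_atTop.2 ⟨D, fun d hDd => ?_⟩)
  set π : (Fin d → Bool) → (Fin D → Bool) := fun x i => x (Fin.castLE hDd i) with hπ
  set g : (Fin d → Bool) → ℝ≥0∞ := fun x => (ρ₀ (π x) : ℝ≥0∞) with hg
  have hfac : (fun u : ℕ → Bool => (ρ₀ (finRestrict D u) : ℝ≥0∞)) = g ∘ finRestrict d := by
    funext u
    rfl
  rw [hfac, map_withDensity_comp μ (measurable_finRestrict d) (measurable_of_countable g)]
  haveI : IsFiniteMeasure (μ.map (finRestrict d)) := Measure.isFiniteMeasure_map μ _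
  exact isBoxTP2_withDensity_of_latticeCondition_finite (μ.map (finRestrict d)) (hμ.map_finRestrict d (hIcc d))
    (g := fun x => ρ₀ (π x)) fun x y => hρ _ _

/-- **Box-TP₂ on `{0,1}^ℕ` is preserved by continuous log-supermodular tilts**: for a finite box-TP₂ measure `μ` on
`{0,1}^ℕ` and a continuous (= quasilocal) `ρ : {0,1}^ℕ → ℝ≥0` with `ρ u · ρ v ≤ ρ (u ⊓ v) · ρ (u ⊔ v)`, the tilted
measure `ρ · μ` is box-TP₂. [this work] -/
theorem IsBoxTP2.withDensity_of_continuous_bool (hμ : IsBoxTP2 μ) {ρ : (ℕ → Bool) → ℝ≥0} (hρc : Continuous ρ)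
    (hρ : ∀ u v, ρ u * ρ v ≤ ρ (u ⊓ v) * ρ (u ⊔ v)) : IsBoxTP2 (μ.withDensity fun u => (ρ u : ℝ≥0∞)) := by
  obtain ⟨x₀, -, hx₀⟩ := isCompact_univ.exists_isMaxOn univ_nonempty hρc.continuousOn
  have hR : ∀ u, ρ u ≤ ρ x₀ := fun u => hx₀ (mem_univ u)
  haveI : IsFiniteMeasure (μ.withDensity fun u => (ρ u : ℝ≥0∞)) := by
    refine isFiniteMeasure_withDensity (ne_of_lt ?_)
    calc ∫⁻ u, (ρ u : ℝ≥0∞) ∂μ ≤ ∫⁻ _, (ρ x₀ : ℝ≥0∞) ∂μ := lintegral_mono fun u => ENNReal.coe_le_coe.2 (hR u)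
      _ = ρ x₀ * μ univ := lintegral_const _
      _ < ∞ := ENNReal.mul_lt_top ENNReal.coe_lt_top (measure_lt_top _ _)
  -- cylinder approximants `ρ ∘ pad_D`, `pad_D u = finExtend D (u|_D) ⊤`
  have hcyl : ∀ D, IsBoxTP2 (μ.withDensity fun u => (ρ (finExtend D (finRestrict D u) true) : ℝ≥0∞)) := fun D =>
    hμ.withDensity_cylinder_bool (ρ₀ := fun a => ρ (finExtend D a true)) fun x y => by
      have h := hρ (finExtend D x true) (finExtend D y true)
      rw [← finExtend_inf, ← finExtend_sup] at h
      simpa using h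
  have hpadc : ∀ D, Continuous fun a : Fin D → Bool => finExtend D a true := fun D => by
    refine continuous_pi fun i => ?_
    by_cases hi : i < D
    · simp only [finExtend, dif_pos hi]
      exact continuous_apply _
    · simp only [finExtend, dif_neg hi]
      exact continuous_const
  have hlim : ∀ u : ℕ → Bool, Tendsto (fun D => finExtend D (finRestrict D u) true) atTop (𝓝 u) := fun u => by
    rw [tendsto_pi_nhds]
    intro i
    refine tendsto_atTop_of_eventually_const (i₀ := i + 1) fun D hD => ?_
    rw [finExtend_of_lt _ _ (Nat.lt_of_succ_le hD)]
    rfl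
  have hconv : ∀ {B : Set (ℕ → Bool)}, MeasurableSet B →
      Tendsto (fun D => μ.withDensity (fun u => (ρ (finExtend D (finRestrict D u) true) : ℝ≥0∞)) B) atTop
        (𝓝 (μ.withDensity (fun u => (ρ u : ℝ≥0∞)) B)) := by
    intro B hB
    simp only [withDensity_apply _ hB]
    refine tendsto_lintegral_of_dominated_convergence (μ := μ.restrict B) (fun _ => (ρ x₀ : ℝ≥0∞))
      (fun D => (ENNReal.continuous_coe.comp hρc).measurable.comp
        ((hpadc D).measurable.comp (measurable_finRestrict D)))
      (fun D => Eventually.of_forall fun u => ENNReal.coe_le_coe.2 (hR _))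
      (by rw [lintegral_const]; exact ENNReal.mul_ne_top ENNReal.coe_ne_top (measure_ne_top _ _))
      (Eventually.of_forall fun u => ?_)
    exact (ENNReal.continuous_coe.tendsto _).comp ((hρc.tendsto u).comp (hlim u))
  refine IsBoxTP2.of_limsup_liminf (L := (atTop : Filter ℕ))
    (μs := fun D => μ.withDensity fun u => (ρ (finExtend D (finRestrict D u) true) : ℝ≥0∞))
    (Eventually.of_forall hcyl) (fun _ => id) (fun _ => id) (fun _ _ _ => rfl) (fun _ _ _ => rfl)
    (fun _ _ _ => rfl) (fun _ _ _ => rfl)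
    (fun D a b => ((hconv (measurableSet_Icc_pi_of_countable a b)).liminf_eq).symm.le)
    (fun D a b => (hconv (measurableSet_Icc_pi_of_countable a b)).limsup_eq.le) (fun a b => tendsto_const_nhds)

end BoolSpins

/-! ### `{−1,+1}^ι`, `ι` countable -/

section SpinConfig

variable {ι : Type*} [Countable ι]

/-- **Box-TP₂ passes from `{0,1}^ι` back to `{−1,+1}^ι`** along the coordinatewise order isomorphism. [folklore] -/
theorem IsBoxTP2.map_piCongrRight_unitsIntEquivBool_symm {μ : Measure (ι → Bool)} (hμ : IsBoxTP2 μ) :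
    IsBoxTP2 (μ.map (MeasurableEquiv.piCongrRight fun _ : ι => unitsIntEquivBool).symm) := by
  refine hμ.map_of_galoisConnection (MeasurableEquiv.measurable _)
    (l := (MeasurableEquiv.piCongrRight fun _ : ι => unitsIntEquivBool))
    (r := (MeasurableEquiv.piCongrRight fun _ : ι => unitsIntEquivBool)) ?_ ?_
    fun a b => measurableSet_Icc_spinConfig a b
  · intro σ u
    constructor
    · intro hle i
      have := galoisConnection_unitsIntEquivBool (σ i) (u i)
      rw [piCongrRight_unitsIntEquivBool_symm_apply]
      exact this.1 (by simpa only [piCongrRight_unitsIntEquivBool_apply] using hle i)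
    · intro hle i
      have := galoisConnection_unitsIntEquivBool (σ i) (u i)
      rw [piCongrRight_unitsIntEquivBool_apply]
      exact this.2 (by simpa only [piCongrRight_unitsIntEquivBool_symm_apply] using hle i)
  · intro u σ
    constructor
    · intro hle i
      have := galoisConnection_unitsIntEquivBool_symm (u i) (σ i)
      rw [piCongrRight_unitsIntEquivBool_apply]
      exact this.1 (by simpa only [piCongrRight_unitsIntEquivBool_symm_apply] using hle i)
    · intro hle i
      have := galoisConnection_unitsIntEquivBool_symm (u i) (σ i)
      rw [piCongrRight_unitsIntEquivBool_symm_apply]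
      exact this.2 (by simpa only [piCongrRight_unitsIntEquivBool_apply] using hle i)

/-- **Box-TP₂ on `{−1,+1}^ι` (`ι ≃ ℕ`) is preserved by continuous log-supermodular tilts** — e.g. Gibbs
modifications by quasilocal ferromagnetic energies of any box-TP₂ spin law. [this work] -/
theorem IsBoxTP2.withDensity_of_continuous_spinConfig (e : ι ≃ ℕ) {μ : Measure (ι → ℤˣ)} [IsFiniteMeasure μ]
    (hμ : IsBoxTP2 μ) {ρ : (ι → ℤˣ) → ℝ≥0} (hρc : Continuous ρ) (hρ : ∀ σ τ, ρ σ * ρ τ ≤ ρ (σ ⊓ τ) * ρ (σ ⊔ τ)) :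
    IsBoxTP2 (μ.withDensity fun σ => (ρ σ : ℝ≥0∞)) := by
  -- the composite measurable/order isomorphism `Φ : {−1,+1}^ι → {0,1}^ℕ` and its inverse `Ψ`
  set Φ₁ : (ι → ℤˣ) ≃ᵐ (ι → Bool) := MeasurableEquiv.piCongrRight fun _ : ι => unitsIntEquivBool with hΦ₁
  set Ψ : (ℕ → Bool) → (ι → ℤˣ) := fun v => Φ₁.symm (reindex (X := Bool) e v) with hΨ
  have hΨm : Measurable Ψ := Φ₁.symm.measurable.comp (measurableEmbedding_reindex e).measurable
  have hΨc : Continuous Ψ := by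
    refine continuous_pi fun i => ?_
    have : (fun v : ℕ → Bool => Ψ v i) = fun v => unitsIntEquivBool.symm (v (e i)) := by
      funext v; rfl
    rw [this]
    exact (continuous_of_discreteTopology (f := (unitsIntEquivBool.symm : Bool → ℤˣ))).comp (continuous_apply _)
  have hΨinf : ∀ v w, Ψ (v ⊓ w) = Ψ v ⊓ Ψ w := fun v w => funext fun i => by
    change unitsIntEquivBool.symm ((v ⊓ w) (e i)) = unitsIntEquivBool.symm (v (e i)) ⊓ unitsIntEquivBool.symm (w (e i))
    rw [Pi.inf_apply]
    exact unitsIntEquivBool_symm_mono.map_min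
  have hΨsup : ∀ v w, Ψ (v ⊔ w) = Ψ v ⊔ Ψ w := fun v w => funext fun i => by
    change unitsIntEquivBool.symm ((v ⊔ w) (e i)) = unitsIntEquivBool.symm (v (e i)) ⊔ unitsIntEquivBool.symm (w (e i))
    rw [Pi.sup_apply]
    exact unitsIntEquivBool_symm_mono.map_max
  -- the law of `μ` on `{0,1}^ℕ` and its tilt
  set ν : Measure (ℕ → Bool) := (μ.map Φ₁).map (reindex (X := Bool) e).symm with hν
  haveI : IsFiniteMeasure (μ.map Φ₁) := Measure.isFiniteMeasure_map μ _
  haveI : IsFiniteMeasure ν := Measure.isFiniteMeasure_map _ _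
  have hνbox : IsBoxTP2 ν := (isBoxTP2_map_reindex_symm_iff e _).2 hμ.map_piCongrRight_unitsIntEquivBool
  have htilt : IsBoxTP2 (ν.withDensity fun v => (ρ (Ψ v) : ℝ≥0∞)) :=
    hνbox.withDensity_of_continuous_bool (hρc.comp hΨc) fun v w => by rw [hΨinf, hΨsup]; exact hρ _ _
  -- pull back: `μ.withDensity ρ = (ν.withDensity (ρ ∘ Ψ)).map Ψ`
  have hΨΦ : ∀ σ, Ψ ((reindex (X := Bool) e).symm (Φ₁ σ)) = σ := fun σ => by
    simp only [hΨ, OrderIso.apply_symm_apply, MeasurableEquiv.symm_apply_apply]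
  have hid : (fun σ => Ψ ((reindex (X := Bool) e).symm (Φ₁ σ))) = id := funext hΨΦ
  have hback : (ν.withDensity fun v => (ρ (Ψ v) : ℝ≥0∞)).map Ψ = μ.withDensity fun σ => (ρ σ : ℝ≥0∞) := by
    have hρm : Measurable fun σ : ι → ℤˣ => (ρ σ : ℝ≥0∞) := (ENNReal.continuous_coe.comp hρc).measurable
    have h1 : ν = μ.map ((reindex (X := Bool) e).symm ∘ Φ₁) := by
      rw [hν, Measure.map_map (measurableEmbedding_reindex_symm e).measurable Φ₁.measurable]
    rw [h1, show (fun v => (ρ (Ψ v) : ℝ≥0∞)) = (fun σ => (ρ σ : ℝ≥0∞)) ∘ Ψ from rfl,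
      ← map_withDensity_comp _ ((measurableEmbedding_reindex_symm e).measurable.comp Φ₁.measurable)
        (hρm.comp hΨm),
      Measure.map_map hΨm ((measurableEmbedding_reindex_symm e).measurable.comp Φ₁.measurable)]
    simp only [Function.comp_def, hΨΦ, Measure.map_id']
  rw [← hback]
  -- image of a box-TP₂ law under the lattice isomorphism `Ψ`
  refine htilt.map_of_galoisConnection hΨm (l := fun σ => (reindex (X := Bool) e).symm (Φ₁ σ))
    (r := fun σ => (reindex (X := Bool) e).symm (Φ₁ σ)) ?_ ?_ fun a b => measurableSet_Icc_spinConfig a b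
  · intro σ v
    constructor
    · intro h
      have := (show Monotone Ψ from fun v w hvw i => unitsIntEquivBool_symm_mono (hvw (e i))) h
      rwa [hΨΦ] at this
    · intro h
      have hmono : Monotone fun σ : ι → ℤˣ => (reindex (X := Bool) e).symm (Φ₁ σ) := fun σ τ hστ k =>
        unitsIntEquivBool_mono (hστ (e.symm k))
      have := hmono h
      simp only at this
      rwa [show (reindex (X := Bool) e).symm (Φ₁ (Ψ v)) = v from by
        simp only [hΨ, MeasurableEquiv.apply_symm_apply, OrderIso.symm_apply_apply]] at this
  · intro v σ
    constructor
    · intro h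
      have hmono : Monotone fun σ : ι → ℤˣ => (reindex (X := Bool) e).symm (Φ₁ σ) := fun σ τ hστ k =>
        unitsIntEquivBool_mono (hστ (e.symm k))
      have := hmono h
      simp only at this
      rwa [show (reindex (X := Bool) e).symm (Φ₁ (Ψ v)) = v from by
        simp only [hΨ, MeasurableEquiv.apply_symm_apply, OrderIso.symm_apply_apply]] at this
    · intro h
      have := (show Monotone Ψ from fun v w hvw i => unitsIntEquivBool_symm_mono (hvw (e i))) h
      rwa [hΨΦ] at this

/-- **Gibbs modifications on `{−1,+1}^ι`**: for a finite box-TP₂ law `μ` on `{−1,+1}^ι` (`ι ≃ ℕ`) and a continuous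
submodular energy `H` (`H (σ ⊓ τ) + H (σ ⊔ τ) ≤ H σ + H τ`: quasilocal ferromagnetic couplings of any range,
arbitrary fields), `e^{−H} · μ` is box-TP₂ — hence (generation 13) FKG for all measurable monotone functionals,
Sahi-positive of every order given `C_n`, two free local slots and three-site positivity unconditionally.
[this work] -/
theorem IsBoxTP2.withDensity_exp_of_submodular_spinConfig (e : ι ≃ ℕ) {μ : Measure (ι → ℤˣ)} [IsFiniteMeasure μ]
    (hμ : IsBoxTP2 μ) {H : (ι → ℤˣ) → ℝ} (hHc : Continuous H) (hH : ∀ σ τ, H (σ ⊓ τ) + H (σ ⊔ τ) ≤ H σ + H τ) :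
    IsBoxTP2 (μ.withDensity fun σ => ENNReal.ofReal (Real.exp (-H σ))) :=
  hμ.withDensity_of_continuous_spinConfig e (ρ := fun σ => Real.toNNReal (Real.exp (-H σ)))
    (continuous_real_toNNReal.comp (Real.continuous_exp.comp hHc.neg)) fun σ τ => by
      rw [← Real.toNNReal_mul (Real.exp_pos _).le, ← Real.toNNReal_mul (Real.exp_pos _).le, ← Real.exp_add,
        ← Real.exp_add]
      exact Real.toNNReal_le_toNNReal (Real.exp_le_exp.2 (by linarith [hH σ τ]))

end SpinConfig

end Summit.CriticalPhenomena.PercolationContinuityZ3.Theorems.SahiBoxTP2
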